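import Literature.Analysis.FluidPDE.PassiveVectorVarTensorEnergyIdentity
import HarnessLib

/-!
# Uniqueness of `L²ₜH¹ₓ` weak solutions of the VARIABLE-tensor passive-vector equation

Analysis/FluidPDE proof-support file (everything proved; no definitions, no named facts). Two results for
the variable-coefficient anisotropic-viscosity passive-vector equation
`∂ₜw + (b·∇)w + ∇π = ∇·(𝔹(t,y)∇w)`, `∇·w = 0` on `T^d × (0,T)`:

* `integral_sum_entry_mul_self_ge` — **Gårding's inequality for `H¹` weakly divergence-free slices**:
  for `NearIso 𝔸 lo hi`, a coefficient field `ℙ` (smooth, `|ℙ − 𝔸| ≤ δ`, `|ℙ| ≤ B`) and `v ∈ L²(T^d)`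
  weakly divergence free with weak partial derivatives `G c ∈ L²`,
  `(lo − d²δ) ∫ Σ_c ‖G c‖² ≤ ∫ Σ_{l,i,c,e} ℙ_{icle} (G c)_i (G e)_l` — the perturbative Gårding
  inequality of `PassiveVectorVarTensorGarding` (smooth divergence-free fields) passed to the limit along
  the Fourier truncations `P_N v` (`∂_c P_N v = P_N ∂_c v → ∂_c v` in `L²`);
* `ae_eq_of_weakVar` — **uniqueness in the `L²ₜH¹ₓ` class**: two distributional solutions (weak
  formulation against the divergence-free space–time tests, product form) with the same bounded weakly
  divergence-free carrier, the same coefficient field (`(card d)²δ ≤ lo`), the same `L²` datum, both with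
  weakly divergence-free `L²` slices and weak space gradients in `L²(μ_T)`, coincide a.e. on
  `(0,T) × T^d`: their difference solves the problem with datum `0`, and the energy identity
  (`PassiveVectorVarTensorEnergyIdentity.ae_integral_norm_sq_eq_of_weakVar`) with Gårding gives
  `‖w(t)‖² ≤ 0` for a.e. `t` (Lions–Magenes 1972, Chap. 3, Thm. 1.2 / §4.4; Temam 1984, Ch. III Thm. 1.1
  uniqueness part).

Together with `PassiveVectorVarTensorLionsExistence` (existence in this class) this is the well-posedness
of the variable-tensor class in `L²ₜH¹ₓ`.

## References

* J.-L. Lions, E. Magenes, *Non-homogeneous boundary value problems and applications* I (1972), Chap. 3,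
  Thm. 1.2, §4.4. [`LionsMagenes1972`]
* R. Temam, *Navier–Stokes Equations*, 3rd ed. (1984), Ch. III §1, Thm. 1.1. [`Temam1984`]
* M. Giaquinta, *Multiple integrals in the calculus of variations* (Princeton 1983), Ch. III §2. [`Giaquinta1983MultipleIntegrals`]
-/

noncomputable section

open MeasureTheory Set Filter Function TopologicalSpace Complex UnitAddTorus
open scoped ENNReal NNReal InnerProductSpace Topology ComplexConjugate

namespace Literature.Analysis.FluidPDE

namespace Torus

variable {d : Type*} [Fintype d] [DecidableEq d]

/-! ## Gårding's inequality for `H¹` weakly divergence-free slices -/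

/-- `∑ᵢ vᵢ eᵢ = v` in `ℝ^d`. [folklore] -/
private theorem sum_apply_smul_single_V7 (v : EuclideanSpace ℝ d) :
    ∑ i, v i • EuclideanSpace.single i (1 : ℝ) = v := by
  ext i'
  simp [Finset.sum_apply, Pi.single_apply]

/-- **Gårding's inequality for `H¹` weakly divergence-free slices of the variable-tensor form.** For
`NearIso 𝔸 lo hi`, a coefficient field `ℙ` with smooth entries, `|ℙ − 𝔸| ≤ δ` and `|ℙ| ≤ B` entrywise,
and `v ∈ L²(T^d)` weakly divergence free with weak partial derivatives `G c ∈ L²`: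
`(lo − (card d)²δ) ∫ Σ_c ‖G c‖² ≤ ∫ Σ_{l,i,c,e} ℙ_{icle} (G c)_i (G e)_l`
(`integral_inner_viscAdjVar_self_le` on the truncations `P_N v`, and `N → ∞`).
[cite: Giaquinta1983MultipleIntegrals, Ch. III §2 eq. (2.2)–(2.6)] [cite: LionsMagenes1972, Chap. 3 §4.4] -/
theorem integral_sum_entry_mul_self_ge {𝔸 : Visc4 d} {lo hi : ℝ} (h𝔸 : NearIso 𝔸 lo hi)
    {ℙ : UnitAddTorus d → Visc4 d} (hℙ : ∀ i c j e, FunctionSpaces.Torus.IsSmooth (fun y => ℙ y i c j e))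
    {δ : ℝ} (hδ : ∀ y i c j e, |ℙ y i c j e - 𝔸 i c j e| ≤ δ)
    {B : ℝ} (hB : ∀ y i c j e, |ℙ y i c j e| ≤ B)
    {v : UnitAddTorus d → EuclideanSpace ℝ d} (hv : MemLp v 2 volume) (hdiv : FunctionSpaces.Torus.IsWeaklyDivFree v)
    {G : d → UnitAddTorus d → EuclideanSpace ℝ d} (hG : ∀ c, FunctionSpaces.Torus.HasWeakPartialDeriv c v (G c))
    (hG2 : ∀ c, MemLp (G c) 2 volume) :
    (lo - (Fintype.card d : ℝ) ^ 2 * δ) * ∫ x, ∑ c, ‖G c x‖ ^ 2 ≤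
      ∫ x, ∑ l, ∑ i, ∑ c, ∑ e, ℙ x i c l e * (G c x) i * (G e x) l := by
  have hℙc : ∀ i c l e, Continuous (fun y => ℙ y i c l e) := fun i c l e => (hℙ i c l e).continuous
  set lo' : ℝ := lo - (Fintype.card d : ℝ) ^ 2 * δ with hlo'
  set PG : ℕ → d → UnitAddTorus d → EuclideanSpace ℝ d := fun N c => FunctionSpaces.Torus.fourierTruncate N (G c) with hPG
  have hPG2 : ∀ N c, MemLp (PG N c) 2 volume := fun N c => FunctionSpaces.Torus.memLp_fourierTruncate N (G c) 2
  -- ### the inequality at level `N`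
  have hN : ∀ N, lo' * ∑ c, ∫ x, ‖PG N c x‖ ^ 2 ≤
      ∫ x, ∑ l, ∑ i, ∑ c, ∑ e, ℙ x i c l e * (PG N c x) i * (PG N e x) l := by
    intro N
    set ψ := FunctionSpaces.Torus.fourierTruncate N v with hψdef
    have hψ : FunctionSpaces.Torus.IsSmooth ψ := FunctionSpaces.Torus.isSmooth_fourierTruncate N v
    have hψdiv : FunctionSpaces.Torus.IsDivFree ψ := FunctionSpaces.Torus.isDivFree_fourierTruncate hv hdiv N
    -- the derivative components of `ψ` are the truncated weak derivatives
    have hall : ∀ᵐ x ∂volume, ∀ c, FunctionSpaces.Torus.partialDeriv c ψ x = PG N c x :=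
      ae_all_iff.2 fun c => partialDeriv_fourierTruncate_ae_eq_of_hasWeakPartialDeriv hv (hG2 c) (hG c) N
    -- Gårding for the smooth divergence-free `ψ`
    have hGa := integral_inner_viscAdjVar_self_le h𝔸 hℙ hδ hψ hψdiv
    -- the pairing through the (classical = weak) gradient of `ψ`
    set Gm : UnitAddTorus d → EuclideanSpace ℝ d →L[ℝ] EuclideanSpace ℝ d := fun x =>
      ∑ i, ∑ j, ((FunctionSpaces.Torus.partialDeriv j ψ x) i) •
        (EuclideanSpace.proj j : EuclideanSpace ℝ d →L[ℝ] ℝ).smulRight (EuclideanSpace.single i (1 : ℝ)) with hGm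
    have hGapp : ∀ x e, Gm x (EuclideanSpace.single e 1) = FunctionSpaces.Torus.partialDeriv e ψ x := by
      intro x e
      rw [hGm, sum_smul_smulRight_apply_single (fun i j => (FunctionSpaces.Torus.partialDeriv j ψ x) i) e,
        sum_apply_smul_single_V7]
    have hWG : HasWeakGradient ψ Gm := by
      intro e
      rw [show (fun x => Gm x (EuclideanSpace.single e 1)) = FunctionSpaces.Torus.partialDeriv e ψ from
        funext fun x => hGapp x e]
      exact FunctionSpaces.Torus.IsSmooth.hasWeakPartialDeriv FunctionSpaces.Torus.integral_partialDeriv_eq_zero_holds hψ e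
    have hGi : Integrable Gm volume :=
      integrable_sum_smul_smulRight fun i j => ((hψ.partialDeriv j).integrable).eval_piLp i
    have hpair : ∫ x, ⟪ψ x, viscAdjVar ℙ ψ x⟫_ℝ = -∫ x, ∑ l, ∑ i, ∑ c, ∑ e, ℙ x i c l e * (PG N c x) i * (PG N e x) l := by
      rw [integral_inner_viscAdjVar_eq_neg_integral_sum hℙ hψ hψ.integrable hWG hGi]
      simp_rw [hGapp]
      congr 1
      refine integral_congr_ae ?_
      filter_upwards [hall] with x hx
      exact Finset.sum_congr rfl fun l _ => Finset.sum_congr rfl fun i _ => Finset.sum_congr rfl fun c _ =>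
        Finset.sum_congr rfl fun e _ => by rw [hx c, hx e]
    -- the gradient norm of `ψ`
    have hgrad : FunctionSpaces.Torus.gradNormSq ψ = ∑ c, ∫ x, ‖PG N c x‖ ^ 2 := by
      unfold FunctionSpaces.Torus.gradNormSq
      have e : ∫ x, ∑ c, ‖FunctionSpaces.Torus.partialDeriv c ψ x‖ ^ 2 = ∫ x, ∑ c, ‖PG N c x‖ ^ 2 := by
        refine integral_congr_ae ?_
        filter_upwards [hall] with x hx
        exact Finset.sum_congr rfl fun c _ => by rw [hx c]
      rw [e, integral_finsetSum _ fun c _ => (hPG2 N c).integrable_norm_pow two_ne_zero]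
    rw [hpair, hgrad] at hGa
    linarith
  -- ### the limits `N → ∞`
  have hR : Tendsto (fun N => lo' * ∑ c, ∫ x, ‖PG N c x‖ ^ 2) atTop (𝓝 (lo' * ∫ x, ∑ c, ‖G c x‖ ^ 2)) := by
    rw [integral_finsetSum _ fun c _ => (hG2 c).integrable_norm_pow two_ne_zero]
    refine (tendsto_finsetSum _ fun c _ => ?_).const_mul lo'
    have h := tendsto_integral_inner_fourierTruncate_self (hG2 c)
    refine h.congr fun N => integral_congr_ae (ae_of_all _ fun x => ?_)
    exact real_inner_self_eq_norm_sq _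
  have hI : ∀ (F F' : d → UnitAddTorus d → EuclideanSpace ℝ d), (∀ c, MemLp (F c) 2 volume) → (∀ c, MemLp (F' c) 2 volume) →
      Integrable (fun x => ∑ l, ∑ i, ∑ c, ∑ e, ℙ x i c l e * (F c x) i * (F' e x) l) volume := by
    intro F F' hF hF'
    refine integrable_finsetSum _ fun l _ => integrable_finsetSum _ fun i _ =>
      integrable_finsetSum _ fun c _ => integrable_finsetSum _ fun e _ => ?_
    refine Integrable.mono' (((hF c).norm.integrable_mul (hF' e).norm).const_mul B)
      ((((hℙc i c l e).aestronglyMeasurable).mul ((PiLp.continuous_apply 2 _ i).comp_aestronglyMeasurable (hF c).1)).mul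
        ((PiLp.continuous_apply 2 _ l).comp_aestronglyMeasurable (hF' e).1)) (ae_of_all _ fun x => ?_)
    rw [Real.norm_eq_abs, abs_mul, abs_mul]
    calc |ℙ x i c l e| * |(F c x) i| * |(F' e x) l| ≤ B * ‖F c x‖ * ‖F' e x‖ :=
          mul_le_mul (mul_le_mul (hB x i c l e) (FunctionSpaces.Torus.abs_apply_le_norm (F c x) i) (abs_nonneg _)
            ((abs_nonneg _).trans (hB x i c l e))) (FunctionSpaces.Torus.abs_apply_le_norm (F' e x) l) (abs_nonneg _)
            (mul_nonneg ((abs_nonneg _).trans (hB x i c l e)) (norm_nonneg _))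
      _ = B * (‖F c x‖ * ‖F' e x‖) := by ring
  have hL : Tendsto (fun N => ∫ x, ∑ l, ∑ i, ∑ c, ∑ e, ℙ x i c l e * (PG N c x) i * (PG N e x) l) atTop
      (𝓝 (∫ x, ∑ l, ∑ i, ∑ c, ∑ e, ℙ x i c l e * (G c x) i * (G e x) l)) := by
    rw [tendsto_iff_norm_sub_tendsto_zero]
    have hdm : ∀ N c, MemLp (fun x => PG N c x - G c x) 2 volume := fun N c => (hPG2 N c).sub (hG2 c)
    -- split `ℙab − ℙa'b' = ℙ(a−a')b + ℙa'(b−b')`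
    have hsplit : ∀ N, (∫ x, ∑ l, ∑ i, ∑ c, ∑ e, ℙ x i c l e * (PG N c x) i * (PG N e x) l) -
        (∫ x, ∑ l, ∑ i, ∑ c, ∑ e, ℙ x i c l e * (G c x) i * (G e x) l) =
        (∫ x, ∑ l, ∑ i, ∑ c, ∑ e, ℙ x i c l e * ((fun c x => PG N c x - G c x) c x) i * (PG N e x) l) +
          ∫ x, ∑ l, ∑ i, ∑ c, ∑ e, ℙ x i c l e * (G c x) i * ((fun e x => PG N e x - G e x) e x) l := by
      intro N
      rw [← integral_sub (hI _ _ (hPG2 N) (hPG2 N)) (hI _ _ hG2 hG2),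
        ← integral_add (hI _ _ (hdm N) (hPG2 N)) (hI _ _ hG2 (hdm N))]
      refine integral_congr_ae (ae_of_all _ fun x => ?_)
      simp only [PiLp.sub_apply]
      rw [← Finset.sum_sub_distrib, ← Finset.sum_add_distrib]
      refine Finset.sum_congr rfl fun l _ => ?_
      rw [← Finset.sum_sub_distrib, ← Finset.sum_add_distrib]
      refine Finset.sum_congr rfl fun i _ => ?_
      rw [← Finset.sum_sub_distrib, ← Finset.sum_add_distrib]
      refine Finset.sum_congr rfl fun c _ => ?_
      rw [← Finset.sum_sub_distrib, ← Finset.sum_add_distrib]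
      refine Finset.sum_congr rfl fun e _ => ?_
      ring
    have hb1 : ∀ N, |∫ x, ∑ l, ∑ i, ∑ c, ∑ e, ℙ x i c l e * ((fun c x => PG N c x - G c x) c x) i * (PG N e x) l| ≤
        ∑ _l : d, ∑ _i : d, ∑ c, ∑ e, B * (Real.sqrt (∫ x, ‖PG N c x - G c x‖ ^ 2) * Real.sqrt (∫ x, ‖PG N e x‖ ^ 2)) :=
      fun N => abs_integral_sum_entry_mul_le hℙc hB (hdm N) (hPG2 N)
    have hb2 : ∀ N, |∫ x, ∑ l, ∑ i, ∑ c, ∑ e, ℙ x i c l e * (G c x) i * ((fun e x => PG N e x - G e x) e x) l| ≤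
        ∑ _l : d, ∑ _i : d, ∑ c, ∑ e, B * (Real.sqrt (∫ x, ‖G c x‖ ^ 2) * Real.sqrt (∫ x, ‖PG N e x - G e x‖ ^ 2)) :=
      fun N => abs_integral_sum_entry_mul_le hℙc hB hG2 (hdm N)
    have hs : ∀ c, Tendsto (fun N => Real.sqrt (∫ x, ‖PG N c x - G c x‖ ^ 2)) atTop (𝓝 0) := by
      intro c
      have h := tendsto_integral_norm_sq_fourierTruncate_sub_of_memLp (hG2 c)
      have h' := (Real.continuous_sqrt.tendsto 0).comp h
      rw [Real.sqrt_zero] at h'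
      exact h'
    -- `√∫‖P_N G e‖² ≤ √∫‖G e‖²`, a bounded factor
    have hPle : ∀ N e, Real.sqrt (∫ x, ‖PG N e x‖ ^ 2) ≤ Real.sqrt (∫ x, ‖G e x‖ ^ 2) := fun N e =>
      Real.sqrt_le_sqrt (FunctionSpaces.Torus.integral_norm_sq_fourierTruncate_le (hG2 e) N)
    have hlim1 : Tendsto (fun N => ∑ _l : d, ∑ _i : d, ∑ c, ∑ e,
        B * (Real.sqrt (∫ x, ‖PG N c x - G c x‖ ^ 2) * Real.sqrt (∫ x, ‖G e x‖ ^ 2))) atTop (𝓝 0) := by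
      rw [show (0 : ℝ) = ∑ _l : d, ∑ _i : d, ∑ c : d, ∑ e : d, B * (0 * Real.sqrt (∫ x, ‖G e x‖ ^ 2)) by simp]
      exact tendsto_finsetSum _ fun l _ => tendsto_finsetSum _ fun i _ => tendsto_finsetSum _ fun c _ =>
        tendsto_finsetSum _ fun e _ => ((hs c).mul_const _).const_mul B
    have hlim2 : Tendsto (fun N => ∑ _l : d, ∑ _i : d, ∑ c, ∑ e,
        B * (Real.sqrt (∫ x, ‖G c x‖ ^ 2) * Real.sqrt (∫ x, ‖PG N e x - G e x‖ ^ 2))) atTop (𝓝 0) := by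
      rw [show (0 : ℝ) = ∑ _l : d, ∑ _i : d, ∑ c : d, ∑ e : d, B * (Real.sqrt (∫ x, ‖G c x‖ ^ 2) * 0) by simp]
      exact tendsto_finsetSum _ fun l _ => tendsto_finsetSum _ fun i _ => tendsto_finsetSum _ fun c _ =>
        tendsto_finsetSum _ fun e _ => ((hs e).const_mul _).const_mul B
    have hB0 : ∀ c e (x : UnitAddTorus d), 0 ≤ B := fun c e x => (abs_nonneg _).trans (hB x c c e e)
    have hlim := hlim1.add hlim2
    rw [add_zero] at hlim
    refine squeeze_zero (fun N => norm_nonneg _) (fun N => ?_) hlim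
    rw [Real.norm_eq_abs, hsplit N]
    refine (abs_add_le _ _).trans (add_le_add ((hb1 N).trans ?_) (hb2 N))
    refine Finset.sum_le_sum fun l _ => Finset.sum_le_sum fun i _ => Finset.sum_le_sum fun c _ =>
      Finset.sum_le_sum fun e _ => ?_
    exact mul_le_mul_of_nonneg_left (mul_le_mul_of_nonneg_left (hPle N e) (Real.sqrt_nonneg _)) (hB0 c e 0)
  exact le_of_tendsto_of_tendsto' hR hL hN

/-! ## Uniqueness in the `L²ₜH¹ₓ` class -/

section Uniqueness

variable {T : ℝ} {𝔸 : Visc4 d} {𝔹 : ℝ → UnitAddTorus d → Visc4 d}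
  {b : ℝ → UnitAddTorus d → EuclideanSpace ℝ d} {w₀ : UnitAddTorus d → EuclideanSpace ℝ d}

/-- Differences of weak partial derivatives (both pairs integrable). [folklore] -/
private theorem hasWeakPartialDeriv_sub_V7 {i : d} {f₁ f₂ g₁ g₂ : UnitAddTorus d → EuclideanSpace ℝ d}
    (hf₁ : Integrable f₁ volume) (hf₂ : Integrable f₂ volume) (hg₁ : Integrable g₁ volume) (hg₂ : Integrable g₂ volume)
    (h₁ : FunctionSpaces.Torus.HasWeakPartialDeriv i f₁ g₁) (h₂ : FunctionSpaces.Torus.HasWeakPartialDeriv i f₂ g₂) :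
    FunctionSpaces.Torus.HasWeakPartialDeriv i (fun x => f₁ x - f₂ x) (fun x => g₁ x - g₂ x) := by
  intro φ hφ
  simp_rw [smul_sub]
  rw [integral_sub ((hφ.partialDeriv i).integrable_smul hf₁) ((hφ.partialDeriv i).integrable_smul hf₂),
    integral_sub (hφ.integrable_smul hg₁) (hφ.integrable_smul hg₂), h₁ φ hφ, h₂ φ hφ]
  abel

omit [DecidableEq d] in
/-- Slices of an `L²(μ_T)` function are in `L²(T^d)` for a.e. `t ∈ (0,T)` (Tonelli). [folklore] -/
private theorem ae_memLp_two_slice_V7 {T : ℝ} {v : ℝ → UnitAddTorus d → EuclideanSpace ℝ d}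
    (hv : MemLp (uncurry v) 2 (((volume : Measure ℝ).restrict (Ioo 0 T)).prod (volume : Measure (UnitAddTorus d)))) :
    ∀ᵐ t ∂(volume.restrict (Ioo 0 T)), MemLp (v t) 2 volume := by
  have hm := hv.1
  have hfin : ∫⁻ p, ‖uncurry v p‖ₑ ^ 2 ∂(((volume : Measure ℝ).restrict (Ioo 0 T)).prod (volume : Measure (UnitAddTorus d))) < ⊤ := by
    have h2 := lintegral_rpow_enorm_lt_top_of_eLpNorm_lt_top two_ne_zero ENNReal.ofNat_ne_top hv.eLpNorm_lt_top
    simp only [ENNReal.toReal_ofNat, ENNReal.rpow_two] at h2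
    exact h2
  have hmeas : AEMeasurable (fun p : ℝ × UnitAddTorus d => ‖uncurry v p‖ₑ ^ 2)
      (((volume : Measure ℝ).restrict (Ioo 0 T)).prod (volume : Measure (UnitAddTorus d))) := hm.enorm.pow_const 2
  rw [lintegral_prod _ hmeas] at hfin
  filter_upwards [ae_lt_top' hmeas.lintegral_prod_right' hfin.ne, hm.prodMk_left] with t ht hmt
  refine ⟨hmt, ?_⟩
  rw [eLpNorm_eq_lintegral_rpow_enorm_toReal two_ne_zero ENNReal.ofNat_ne_top, ENNReal.toReal_ofNat]
  have e : ∫⁻ x, ‖v t x‖ₑ ^ (2 : ℝ) = ∫⁻ x, ‖v t x‖ₑ ^ 2 := lintegral_congr fun x => by rw [ENNReal.rpow_two]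
  rw [e]
  exact ENNReal.rpow_lt_top_of_nonneg (by norm_num) ht.ne

set_option maxHeartbeats 800000 in
/-- **Uniqueness of `L²ₜH¹ₓ` weak solutions of the variable-tensor passive-vector equation.** Let
`NearIso 𝔸 lo hi`, let `𝔹` have smooth slices, `𝔹`, `∂_y𝔹` jointly continuous, `|𝔹 − 𝔸| ≤ δ` entrywise
with `(card d)²δ ≤ lo`, let the carrier satisfy `‖b‖ ≤ M` a.e. with weakly divergence-free slices, and let
`w₁`, `w₂ ∈ L²((0,T) × T^d)` both solve the weak formulation (product form, divergence-free space–time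
tests) with the same datum `w₀ ∈ L²`, both with weakly divergence-free `L²` slices and weak space
gradients `G₁`, `G₂` in `L²(μ_T)`. Then `w₁ = w₂` a.e. on `(0,T) × T^d` (energy identity for the
difference, Gårding). [cite: LionsMagenes1972, Chap. 3 Thm. 1.2] [cite: Temam1984, Ch. III §1 Thm. 1.1] -/
theorem ae_eq_of_weakVar {lo hi : ℝ} (h𝔸 : NearIso 𝔸 lo hi)
    (h𝔹s : ∀ t i c j e, FunctionSpaces.Torus.IsSmooth (fun y => 𝔹 t y i c j e))
    (h𝔹c : ∀ i c j e, Continuous (uncurry fun t y => 𝔹 t y i c j e))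
    (h𝔹d : ∀ i c j e e', Continuous (uncurry fun t y =>
      FunctionSpaces.Torus.partialDeriv e' (fun y => 𝔹 t y i c j e) y))
    {δ : ℝ} (hδ0 : 0 ≤ δ) (hδ : ∀ t y i c j e, |𝔹 t y i c j e - 𝔸 i c j e| ≤ δ)
    (hlo : (Fintype.card d : ℝ) ^ 2 * δ ≤ lo)
    (hbm : AEStronglyMeasurable (uncurry b) (((volume : Measure ℝ).restrict (Ioo 0 T)).prod volume)) {M : ℝ}
    (hM : 0 ≤ M)
    (hbM : ∀ᵐ p ∂(((volume : Measure ℝ).restrict (Ioo 0 T)).prod (volume : Measure (UnitAddTorus d))), ‖uncurry b p‖ ≤ M)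
    (hbdiv : ∀ᵐ t ∂(volume.restrict (Ioo 0 T)), FunctionSpaces.Torus.IsWeaklyDivFree (b t))
    {w₁ w₂ : ℝ → UnitAddTorus d → EuclideanSpace ℝ d} {G₁ G₂ : ℝ → d → UnitAddTorus d → EuclideanSpace ℝ d}
    (hw₁ : MemLp (uncurry w₁) 2 (((volume : Measure ℝ).restrict (Ioo 0 T)).prod volume))
    (hw₂ : MemLp (uncurry w₂) 2 (((volume : Measure ℝ).restrict (Ioo 0 T)).prod volume))
    (hdiv₁ : ∀ᵐ t ∂(volume.restrict (Ioo 0 T)), FunctionSpaces.Torus.IsWeaklyDivFree (w₁ t))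
    (hdiv₂ : ∀ᵐ t ∂(volume.restrict (Ioo 0 T)), FunctionSpaces.Torus.IsWeaklyDivFree (w₂ t))
    (hG₁ : ∀ᵐ t ∂(volume.restrict (Ioo 0 T)), ∀ c, FunctionSpaces.Torus.HasWeakPartialDeriv c (w₁ t) (G₁ t c))
    (hG₂ : ∀ᵐ t ∂(volume.restrict (Ioo 0 T)), ∀ c, FunctionSpaces.Torus.HasWeakPartialDeriv c (w₂ t) (G₂ t c))
    (hG₁2 : ∀ c, MemLp (uncurry (G₁ · c)) 2 (((volume : Measure ℝ).restrict (Ioo 0 T)).prod volume))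
    (hG₂2 : ∀ c, MemLp (uncurry (G₂ · c)) 2 (((volume : Measure ℝ).restrict (Ioo 0 T)).prod volume))
    (hweak₁ : ∀ Ψ : ℝ → UnitAddTorus d → EuclideanSpace ℝ d, FunctionSpaces.Torus.IsSpaceTimeTest T Ψ →
      (∀ t, FunctionSpaces.Torus.IsDivFree (Ψ t)) →
      (∫ p, ⟪w₁ p.1 p.2, FunctionSpaces.Torus.timeDeriv Ψ p.1 p.2 +
          FunctionSpaces.Torus.convect (b p.1) (Ψ p.1) p.2 + viscAdjVar (𝔹 p.1) (Ψ p.1) p.2⟫_ℝ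
          ∂(((volume : Measure ℝ).restrict (Ioo 0 T)).prod volume)) + ∫ x, ⟪w₀ x, Ψ 0 x⟫_ℝ = 0)
    (hweak₂ : ∀ Ψ : ℝ → UnitAddTorus d → EuclideanSpace ℝ d, FunctionSpaces.Torus.IsSpaceTimeTest T Ψ →
      (∀ t, FunctionSpaces.Torus.IsDivFree (Ψ t)) →
      (∫ p, ⟪w₂ p.1 p.2, FunctionSpaces.Torus.timeDeriv Ψ p.1 p.2 +
          FunctionSpaces.Torus.convect (b p.1) (Ψ p.1) p.2 + viscAdjVar (𝔹 p.1) (Ψ p.1) p.2⟫_ℝ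
          ∂(((volume : Measure ℝ).restrict (Ioo 0 T)).prod volume)) + ∫ x, ⟪w₀ x, Ψ 0 x⟫_ℝ = 0) :
    uncurry w₁ =ᵐ[((volume : Measure ℝ).restrict (Ioo 0 T)).prod volume] uncurry w₂ := by
  set μ : Measure (ℝ × UnitAddTorus d) := ((volume : Measure ℝ).restrict (Ioo 0 T)).prod volume with hμ
  -- the difference and its data
  set w : ℝ → UnitAddTorus d → EuclideanSpace ℝ d := fun t x => w₁ t x - w₂ t x with hw
  set Gw : ℝ → d → UnitAddTorus d → EuclideanSpace ℝ d := fun t c x => G₁ t c x - G₂ t c x with hGw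
  have hw2 : MemLp (uncurry w) 2 μ := hw₁.sub hw₂
  have hGw2 : ∀ c, MemLp (uncurry (Gw · c)) 2 μ := fun c => (hG₁2 c).sub (hG₂2 c)
  have hw₁s := ae_memLp_two_slice_V7 hw₁
  have hw₂s := ae_memLp_two_slice_V7 hw₂
  have hG₁s : ∀ᵐ t ∂(volume.restrict (Ioo 0 T)), ∀ c, MemLp (G₁ t c) 2 volume :=
    ae_all_iff.2 fun c => ae_memLp_two_slice_V7 (v := fun t x => G₁ t c x) (hG₁2 c)
  have hG₂s : ∀ᵐ t ∂(volume.restrict (Ioo 0 T)), ∀ c, MemLp (G₂ t c) 2 volume :=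
    ae_all_iff.2 fun c => ae_memLp_two_slice_V7 (v := fun t x => G₂ t c x) (hG₂2 c)
  have hw2s : ∀ᵐ t ∂(volume.restrict (Ioo 0 T)), MemLp (w t) 2 volume := by
    filter_upwards [hw₁s, hw₂s] with t h1 h2
    exact h1.sub h2
  have hdivw : ∀ᵐ t ∂(volume.restrict (Ioo 0 T)), FunctionSpaces.Torus.IsWeaklyDivFree (w t) := by
    filter_upwards [hdiv₁, hdiv₂, hw₁s, hw₂s] with t h1 h2 hm1 hm2
    intro θ hθ
    have i1 := FunctionSpaces.Torus.integrable_inner_of_continuous (hm1.integrable one_le_two) hθ.gradient.continuous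
    have i2 := FunctionSpaces.Torus.integrable_inner_of_continuous (hm2.integrable one_le_two) hθ.gradient.continuous
    simp only [hw, inner_sub_left]
    rw [integral_sub i1 i2, h1 θ hθ, h2 θ hθ, sub_zero]
  have hGw : ∀ᵐ t ∂(volume.restrict (Ioo 0 T)), ∀ c, FunctionSpaces.Torus.HasWeakPartialDeriv c (w t) (Gw t c) := by
    filter_upwards [hG₁, hG₂, hw₁s, hw₂s, hG₁s, hG₂s] with t h1 h2 hm1 hm2 hg1 hg2
    intro c
    exact hasWeakPartialDeriv_sub_V7 (hm1.integrable one_le_two) (hm2.integrable one_le_two)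
      ((hg1 c).integrable one_le_two) ((hg2 c).integrable one_le_two) (h1 c) (h2 c)
  -- the weak formulation for the difference, datum `0`
  have hweak : ∀ Ψ : ℝ → UnitAddTorus d → EuclideanSpace ℝ d, FunctionSpaces.Torus.IsSpaceTimeTest T Ψ →
      (∀ t, FunctionSpaces.Torus.IsDivFree (Ψ t)) →
      (∫ p, ⟪w p.1 p.2, FunctionSpaces.Torus.timeDeriv Ψ p.1 p.2 +
          FunctionSpaces.Torus.convect (b p.1) (Ψ p.1) p.2 + viscAdjVar (𝔹 p.1) (Ψ p.1) p.2⟫_ℝ ∂μ) +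
        ∫ x, ⟪(fun _ => (0 : EuclideanSpace ℝ d)) x, Ψ 0 x⟫_ℝ = 0 := by
    intro Ψ hΨ hΨdiv
    have hOp : MemLp (fun p : ℝ × UnitAddTorus d => FunctionSpaces.Torus.timeDeriv Ψ p.1 p.2 +
        FunctionSpaces.Torus.convect (b p.1) (Ψ p.1) p.2 + viscAdjVar (𝔹 p.1) (Ψ p.1) p.2) 2 μ := by
      refine ((memLp_two_dampedOpVar h𝔹s h𝔹c h𝔹d hΨ hbm hbM).add hΨ.memLp_two_uncurry).ae_eq
        (ae_of_all _ fun p => ?_)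
      simp only [Pi.add_apply, Function.uncurry]
      abel
    have hint : ∀ {v : ℝ → UnitAddTorus d → EuclideanSpace ℝ d}, MemLp (uncurry v) 2 μ →
        Integrable (fun p : ℝ × UnitAddTorus d => ⟪v p.1 p.2, FunctionSpaces.Torus.timeDeriv Ψ p.1 p.2 +
          FunctionSpaces.Torus.convect (b p.1) (Ψ p.1) p.2 + viscAdjVar (𝔹 p.1) (Ψ p.1) p.2⟫_ℝ) μ := by
      intro v hv
      exact (hv.norm.integrable_mul hOp.norm).mono' (hv.aestronglyMeasurable.inner hOp.aestronglyMeasurable)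
        (ae_of_all _ fun p => norm_inner_le_norm (uncurry v p) _)
    have h1 := hweak₁ Ψ hΨ hΨdiv
    have h2 := hweak₂ Ψ hΨ hΨdiv
    simp only [hw, inner_sub_left, inner_zero_left, integral_zero, add_zero]
    rw [integral_sub (hint hw₁) (hint hw₂)]
    linarith
  -- a bound for the entries of `𝔹`
  set B : ℝ := δ + ∑ i, ∑ c, ∑ j, ∑ e, |𝔸 i c j e| with hBdef
  have hB0 : 0 ≤ B := add_nonneg hδ0 (by positivity)
  have hAle : ∀ i c j e, |𝔸 i c j e| ≤ ∑ i', ∑ c', ∑ j', ∑ e', |𝔸 i' c' j' e'| := by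
    intro i c j e
    calc |𝔸 i c j e| ≤ ∑ e', |𝔸 i c j e'| :=
          Finset.single_le_sum (f := fun e' => |𝔸 i c j e'|) (fun _ _ => abs_nonneg _) (Finset.mem_univ e)
      _ ≤ ∑ j', ∑ e', |𝔸 i c j' e'| :=
          Finset.single_le_sum (f := fun j' => ∑ e', |𝔸 i c j' e'|) (fun _ _ => by positivity) (Finset.mem_univ j)
      _ ≤ ∑ c', ∑ j', ∑ e', |𝔸 i c' j' e'| :=
          Finset.single_le_sum (f := fun c' => ∑ j', ∑ e', |𝔸 i c' j' e'|) (fun _ _ => by positivity) (Finset.mem_univ c)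
      _ ≤ ∑ i', ∑ c', ∑ j', ∑ e', |𝔸 i' c' j' e'| :=
          Finset.single_le_sum (f := fun i' => ∑ c', ∑ j', ∑ e', |𝔸 i' c' j' e'|) (fun _ _ => by positivity) (Finset.mem_univ i)
  have hB : ∀ t y i c j e, |𝔹 t y i c j e| ≤ B := by
    intro t y i c j e
    calc |𝔹 t y i c j e| = |(𝔹 t y i c j e - 𝔸 i c j e) + 𝔸 i c j e| := by rw [sub_add_cancel]
      _ ≤ |𝔹 t y i c j e - 𝔸 i c j e| + |𝔸 i c j e| := abs_add_le _ _
      _ ≤ δ + ∑ i', ∑ c', ∑ j', ∑ e', |𝔸 i' c' j' e'| := add_le_add (hδ t y i c j e) (hAle i c j e)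
  -- the energy identity for the difference (datum `0`)
  have hz₀ : MemLp (fun _ : UnitAddTorus d => (0 : EuclideanSpace ℝ d)) 2 volume := memLp_const 0
  have hzdiv : FunctionSpaces.Torus.IsWeaklyDivFree (fun _ : UnitAddTorus d => (0 : EuclideanSpace ℝ d)) :=
    fun θ hθ => by simp
  have hE := ae_integral_norm_sq_eq_of_weakVar h𝔹s h𝔹c h𝔹d hB0 hB hw2 hw2s hdivw hGw hGw2 hbm hM hbM hbdiv hweak hz₀ hzdiv
  -- the dissipation is nonnegative at a.e. time (Gårding for `H¹` slices)
  have hDnn : ∀ᵐ τ ∂(volume.restrict (Ioo 0 T)),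
      0 ≤ ∫ x, ∑ l, ∑ i, ∑ c, ∑ e, 𝔹 τ x i c l e * (Gw τ c x) i * (Gw τ e x) l := by
    have hGws : ∀ᵐ t ∂(volume.restrict (Ioo 0 T)), ∀ c, MemLp (Gw t c) 2 volume :=
      ae_all_iff.2 fun c => ae_memLp_two_slice_V7 (v := fun t x => Gw t c x) (hGw2 c)
    filter_upwards [hw2s, hdivw, hGw, hGws] with τ h2 hdw hG hG2
    have h := integral_sum_entry_mul_self_ge h𝔸 (h𝔹s τ) (hδ τ) (hB τ) h2 hdw hG hG2
    have h0 : 0 ≤ (lo - (Fintype.card d : ℝ) ^ 2 * δ) * ∫ x, ∑ c, ‖Gw τ c x‖ ^ 2 :=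
      mul_nonneg (sub_nonneg.2 hlo) (integral_nonneg fun x => Finset.sum_nonneg fun _ _ => sq_nonneg _)
    linarith
  have hDnn' : ∀ᵐ τ ∂(volume : Measure ℝ), τ ∈ Ioo 0 T →
      0 ≤ ∫ x, ∑ l, ∑ i, ∑ c, ∑ e, 𝔹 τ x i c l e * (Gw τ c x) i * (Gw τ e x) l :=
    (ae_restrict_iff' measurableSet_Ioo).1 hDnn
  -- slices of the difference vanish
  have hzero : ∀ᵐ t ∂(volume.restrict (Ioo 0 T)), w t =ᵐ[volume] 0 := by
    filter_upwards [hE, hw2s, ae_restrict_mem measurableSet_Ioo] with t ht hm htI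
    have hsub : Ioc 0 t ⊆ Ioo 0 T := Ioc_subset_Ioo_right htI.2
    have hpos : 0 ≤ ∫ τ in Ioc 0 t, ∫ x, ∑ l, ∑ i, ∑ c, ∑ e, 𝔹 τ x i c l e * (Gw τ c x) i * (Gw τ e x) l :=
      integral_nonneg_of_ae ((ae_restrict_iff' measurableSet_Ioc).2 (hDnn'.mono fun τ hτ hτI => hτ (hsub hτI)))
    have hle : ∫ x, ‖w t x‖ ^ 2 ≤ 0 := by
      have e0 : (∫ x, ‖(fun _ : UnitAddTorus d => (0 : EuclideanSpace ℝ d)) x‖ ^ 2) = 0 := by simp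
      rw [ht, e0]
      linarith
    have hi : Integrable (fun x => ‖w t x‖ ^ 2) volume := hm.integrable_norm_pow two_ne_zero
    have h0 : ∫ x, ‖w t x‖ ^ 2 = 0 := le_antisymm hle (integral_nonneg fun x => sq_nonneg _)
    have hae := (integral_eq_zero_iff_of_nonneg (fun x => sq_nonneg _) hi).1 h0
    filter_upwards [hae] with x hx
    have hx' : ‖w t x‖ ^ 2 = 0 := hx
    rw [Pi.zero_apply, ← norm_eq_zero]
    exact pow_eq_zero_iff two_ne_zero |>.1 hx'
  -- conclude on the product
  have hlin : ∫⁻ p, ‖uncurry w p‖ₑ ∂μ = 0 := by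
    rw [hμ, lintegral_prod _ hw2.1.enorm]
    have e : ∀ᵐ t ∂(volume.restrict (Ioo 0 T)), ∫⁻ x, ‖uncurry w (t, x)‖ₑ = 0 := by
      filter_upwards [hzero] with t ht
      have hx0 : (fun x => ‖uncurry w (t, x)‖ₑ) =ᵐ[volume] fun _ => (0 : ℝ≥0∞) := ht.mono fun x hx => by
        simp only [Function.uncurry_apply_pair, hx, Pi.zero_apply, enorm_zero]
      rw [lintegral_congr_ae hx0, lintegral_zero]
    rw [lintegral_congr_ae e, lintegral_zero]
  have hw0 : uncurry w =ᵐ[μ] 0 := by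
    have h := (lintegral_eq_zero_iff' hw2.1.enorm).1 hlin
    filter_upwards [h] with p hp
    simpa using hp
  filter_upwards [hw0] with p hp
  have : w₁ p.1 p.2 - w₂ p.1 p.2 = 0 := hp
  exact sub_eq_zero.1 this

end Uniqueness

end Torus

end Literature.Analysis.FluidPDE

end
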